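import Summits.QuantumFields.QCD.Theorems.PauliWegnerSeaTiltedFlatness
import Literature.MathematicalPhysics.QuantumFieldTheory.TorusFreeTransfer

/-!
# Uniform-window negative moments of the Wilson fermion determinant
(crux stmt-QuantumFields-9151 `PauliWegnerSea.PhaseQuenchedFlavourDecay`, line `crossing-split-integrability`,
lead c4 — registered additive stub `stub_wilsonDetNegMoment`)

**Theorem.** There is `s₀ > 0` (the single-link Remez small-ball exponent of the circle-transport machinery of
crux `TiltedFlatness`, degree `48`, ONE listed link) such that for every `0 < s < s₀`, every torus of side
`L ≥ 4`, every inverse coupling `β` and every bare mass `M`, the negative power `‖det D_W(U; M)‖^{-s}` of the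
one-flavour Wilson determinant is integrable under the Wilson measure `μ_W`.  Quantitatively, under product Haar,
`∫ ‖det D_W(U;M)‖^{-s} dHaar^{⊗E}(U) ≤ K_s^{#E} ‖det D_W(U₀;M)‖^{-s}` for EVERY reference field `U₀`
(`lintegral_pi_negPow_det_le`), with `K_s` depending on `s` only.

Proof.  (1) SINGLE LINK: for fixed outside field `U` and link `e`, `g ↦ ‖det D_W(U[e ↦ g]; M)‖` is a
one-coordinate continuous function on `SU(3)^E` whose square is a trigonometric polynomial of degree `≤ 48` along
every two-sided circle `A T(t) B` (`CircleTransport.stub_bandLimit` at `N_f = 1`), so the abstract Haar small balls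
of `CircleTransport.stub_haarSmallBalls` (with the Euler word and the flat-torus small balls) give
`Haar{g : ‖det(U[e↦g])‖ ≤ ε ‖det U‖} ≤ C ε^c`, uniformly in `L ≥ 4`, `M`, `U`, `e`
(`exists_singleLink_smallBalls`).  (2) LAYER CAKE (`stub_negMomentOfSmallBalls`, landed): hence
`∫ ‖det(U[e↦g])‖^{-s} dg ≤ K ‖det U‖^{-s}` for `s < c` and the singular section is Haar-null.  (3) INDUCTION over
the links (`stub_piMarginalInduction`, landed) in `ℝ≥0∞` with `(ofReal ‖det‖)^{-s}` (`= ⊤` on the singular set,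
where the single-link domination is trivial).  (4) `μ_W ≤ (Z⁻¹ e^{|β| S_max}) · Haar^{⊗E}`.
The two abstract inputs (2), (3) are taken as HYPOTHESES (`hA`, `hB`) by the `_of` theorems (registered form
`stub_wilsonDetNegMomentOf`); the companion file `…WilsonDetNegMomentFinal` supplies the landed stubs by name.
-/

noncomputable section

namespace Summit.QuantumFields.QCD.Cruxes.PhaseQuenchedFlavourDecay.CrossingSplitIntegrability

open scoped BigOperators ENNReal
open MeasureTheory Filter Set
open Literature.MathematicalPhysics.QuantumFieldTheory Literature.MathematicalPhysics.QuantumLattice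
  Literature.Probability.LatticeModels
open Summit.QuantumFields.QCD.Theorems.CircleTransport

section Inputs

/-! The two abstract inputs are section hypotheses: `hA` = the statement of the landed stub
`stub_negMomentOfSmallBalls` (layer cake), `hB` = the statement of the landed stub `stub_piMarginalInduction`
(induction over the coordinates of a product probability space). -/
variable
  (hA : ∀ (C c s : ℝ), 0 ≤ C → 0 < s → s < c → ∃ K : ℝ, 0 < K ∧
    ∀ (Ω : Type) [MeasurableSpace Ω] (μ : Measure Ω) [IsProbabilityMeasure μ] (F : Ω → ℝ) (F₀ : ℝ),
      Measurable F → (∀ ω, 0 ≤ F ω) → 0 < F₀ →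
      (∀ ε : ℝ, 0 < ε → (μ {ω | F ω ≤ ε * F₀}).toReal ≤ C * ε ^ c) →
        Integrable (fun ω => F ω ^ (-s)) μ ∧ ∫ ω, F ω ^ (-s) ∂μ ≤ K * F₀ ^ (-s))
  (hB : ∀ (E X : Type) [Fintype E] [DecidableEq E] [MeasurableSpace X] (μ : Measure X) [IsProbabilityMeasure μ]
    (f : (E → X) → ℝ≥0∞), Measurable f → ∀ C : ℝ≥0∞,
    (∀ (e : E) (x : E → X), ∫⁻ g, f (Function.update x e g) ∂μ ≤ C * f x) →
      ∀ x₀ : E → X, ∫⁻ x, f x ∂(Measure.pi fun _ : E => μ) ≤ C ^ Fintype.card E * f x₀)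

variable {L : ℕ} [NeZero L]

/-- The one-flavour `diracMatrix` determinant has the norm of the Wilson determinant. -/
theorem norm_det_diracMatrix_one_flavour (U : GaugeConfig 4 L SU3) (M : ℝ) :
    ‖(diracMatrix U (fun _ : Fin 1 => M)).det‖ = ‖(wilsonDirac (fundamentalRep (Fin 3)) U M 1).det‖ := by
  rw [det_diracMatrix, Fin.prod_univ_one]

/-- `g ↦ D_W(U[e ↦ g]; M)` has a continuous determinant norm. -/
theorem continuous_norm_det_wilsonDirac_update (U : GaugeConfig 4 L SU3) (M : ℝ) (e : Edge 4 L) :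
    Continuous fun g : SU3 => ‖(wilsonDirac (fundamentalRep (Fin 3)) (Function.update U e g) M 1).det‖ := by
  have hupd : Continuous fun g : SU3 => Function.update U e g := continuous_const.update e continuous_id
  have h := ((continuous_det_diracMatrix (S := L) (fun _ : Fin 1 => M)).comp hupd).norm
  simp only [Function.comp_def, norm_det_diracMatrix_one_flavour] at h
  exact h

/-- `U ↦ ‖det D_W(U; M)‖` is continuous. -/
theorem continuous_norm_det_wilsonDirac (M : ℝ) :
    Continuous fun U : GaugeConfig 4 L SU3 => ‖(wilsonDirac (fundamentalRep (Fin 3)) U M 1).det‖ := by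
  have h := (continuous_det_diracMatrix (S := L) (fun _ : Fin 1 => M)).norm
  simp only [norm_det_diracMatrix_one_flavour] at h
  exact h

omit [NeZero L] in
/-- **(1) Single-link small balls for the Wilson determinant**, uniformly in `L ≥ 4`, `M`, `U`, `e`:
`Haar{g : ‖det D_W(U[e↦g];M)‖ ≤ ε ‖det D_W(U;M)‖} ≤ C ε^c` whenever `det D_W(U;M) ≠ 0`. -/
theorem exists_singleLink_smallBalls :
    ∃ C c : ℝ, 0 < C ∧ 0 < c ∧ ∀ (L : ℕ) [NeZero L], 4 ≤ L →
      ∀ (M : ℝ) (U : GaugeConfig 4 L SU3) (e : Edge 4 L),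
        (wilsonDirac (fundamentalRep (Fin 3)) U M 1).det ≠ 0 → ∀ ε : ℝ, 0 < ε →
          ((haarProbability SU3) {g : SU3 |
              ‖(wilsonDirac (fundamentalRep (Fin 3)) (Function.update U e g) M 1).det‖ ≤
                ε * ‖(wilsonDirac (fundamentalRep (Fin 3)) U M 1).det‖}).toReal ≤ C * ε ^ c := by
  obtain ⟨T, hT⟩ := exists_diagCircle
  have hW := stub_eulerWord T hT
  have hB := stub_bandLimit T hT
  obtain ⟨C, c, hC, hc, hFS⟩ :=
    stub_haarSmallBalls T hT hW (stub_torusSmallBalls stub_circleEngine.1 stub_circleEngine.2) (48 * 1) 1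
  refine ⟨C, c, hC, hc, ?_⟩
  intro L _ hL M U e hdet ε hε
  set mq : Fin 1 → ℝ := fun _ => M with hmq
  set F : (Edge 4 L → SU3) → ℝ := fun W => ‖(diracMatrix (Function.update U e (W e)) mq).det‖ with hF
  have hFc : Continuous F :=
    ((continuous_det_diracMatrix (S := L) mq).comp (continuous_const.update e (continuous_apply e))).norm
  have hF0 : ∀ W, 0 ≤ F W := fun W => norm_nonneg _
  have hdep : ∀ W W' : Edge 4 L → SU3,
      (∀ i : Unit, W ((fun _ : Unit => e) i) = W' ((fun _ : Unit => e) i)) → F W = F W' := by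
    intro W W' h
    simp only [hF, h ()]
  have hband : ∀ (W : Edge 4 L → SU3) (i : Unit) (A B : SU3), ∃ a : ℤ → ℂ, ∀ t : ℝ,
      ((F (Function.update W ((fun _ : Unit => e) i) (A * T t * B)) ^ 2 : ℝ) : ℂ) =
        ∑ k ∈ Finset.Icc (-((48 * 1 : ℕ) : ℤ)) ((48 * 1 : ℕ) : ℤ),
          a k * Complex.exp ((k : ℂ) * (t : ℂ) * Complex.I) := by
    intro W i A B
    obtain ⟨a, ha⟩ := hB 1 mq L hL U e A B
    refine ⟨a, fun t => ?_⟩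
    simp only [hF, Function.update_self]
    exact ha t
  have hFU : F U = ‖(wilsonDirac (fundamentalRep (Fin 3)) U M 1).det‖ := by
    simp only [hF, Function.update_eq_self]
    exact norm_det_diracMatrix_one_flavour U M
  have hFU0 : 0 < F U := by rw [hFU]; exact norm_pos_iff.2 hdet
  have hsb := hFS (Edge 4 L) Unit (fun _ => e) (by simp) F hFc hF0 hdep hband U hFU0 ε hε
  have hS : MeasurableSet {g : SU3 |
      ‖(wilsonDirac (fundamentalRep (Fin 3)) (Function.update U e g) M 1).det‖ ≤
        ε * ‖(wilsonDirac (fundamentalRep (Fin 3)) U M 1).det‖} :=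
    measurableSet_le (continuous_norm_det_wilsonDirac_update U M e).measurable measurable_const
  have hset : {W : Edge 4 L → SU3 | F W ≤ ε * F U} = (Function.eval e) ⁻¹' {g : SU3 |
      ‖(wilsonDirac (fundamentalRep (Fin 3)) (Function.update U e g) M 1).det‖ ≤
        ε * ‖(wilsonDirac (fundamentalRep (Fin 3)) U M 1).det‖} := by
    ext W
    simp only [Set.mem_setOf_eq, Set.mem_preimage, Function.eval, hF, hmq, norm_det_diracMatrix_one_flavour,
      Function.update_eq_self]
  rw [hset, (MeasureTheory.measurePreserving_eval (fun _ : Edge 4 L => haarProbability SU3) e).measure_preimage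
    hS.nullMeasurableSet] at hsb
  exact hsb

include hA in
omit [NeZero L] in
/-- **(2) Single-link negative moments** (from (1) and the layer-cake input): for `0 < s < c` there is `K` with
`∫ ‖det D_W(U[e↦g];M)‖^{-s} dHaar(g) ≤ K ‖det D_W(U;M)‖^{-s}` (and integrability), whenever `det D_W(U;M) ≠ 0`;
moreover the singular section `{g : det D_W(U[e↦g];M) = 0}` is Haar-null. -/
theorem exists_singleLink_negMoment_of :
    ∃ c : ℝ, 0 < c ∧ ∀ s : ℝ, 0 < s → s < c → ∃ K : ℝ, 0 < K ∧ ∀ (L : ℕ) [NeZero L], 4 ≤ L →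
      ∀ (M : ℝ) (U : GaugeConfig 4 L SU3) (e : Edge 4 L), (wilsonDirac (fundamentalRep (Fin 3)) U M 1).det ≠ 0 →
        Integrable (fun g : SU3 =>
            ‖(wilsonDirac (fundamentalRep (Fin 3)) (Function.update U e g) M 1).det‖ ^ (-s)) (haarProbability SU3) ∧
        ∫ g, ‖(wilsonDirac (fundamentalRep (Fin 3)) (Function.update U e g) M 1).det‖ ^ (-s) ∂(haarProbability SU3) ≤
          K * ‖(wilsonDirac (fundamentalRep (Fin 3)) U M 1).det‖ ^ (-s) ∧
        (haarProbability SU3) {g : SU3 | (wilsonDirac (fundamentalRep (Fin 3)) (Function.update U e g) M 1).det = 0} = 0 := by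
  obtain ⟨C, c, hC, hc, hSB⟩ := exists_singleLink_smallBalls
  refine ⟨c, hc, fun s hs hsc => ?_⟩
  obtain ⟨K, hK, hNM⟩ := hA C c s hC.le hs hsc
  refine ⟨K, hK, ?_⟩
  intro L _ hL M U e hdet
  set φ : SU3 → ℝ := fun g => ‖(wilsonDirac (fundamentalRep (Fin 3)) (Function.update U e g) M 1).det‖ with hφ
  set F₀ : ℝ := ‖(wilsonDirac (fundamentalRep (Fin 3)) U M 1).det‖ with hF₀
  have hF₀pos : 0 < F₀ := norm_pos_iff.2 hdet
  have hφm : Measurable φ := (continuous_norm_det_wilsonDirac_update U M e).measurable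
  have hφ0 : ∀ g, 0 ≤ φ g := fun g => norm_nonneg _
  have hsb : ∀ ε : ℝ, 0 < ε → ((haarProbability SU3) {g | φ g ≤ ε * F₀}).toReal ≤ C * ε ^ c :=
    fun ε hε => hSB L hL M U e hdet ε hε
  obtain ⟨hint, hle⟩ := hNM SU3 (haarProbability SU3) φ F₀ hφm hφ0 hF₀pos hsb
  refine ⟨hint, hle, ?_⟩
  -- the singular section is null: it lies in every small ball
  set m : ℝ≥0∞ := (haarProbability SU3) {g : SU3 |
    (wilsonDirac (fundamentalRep (Fin 3)) (Function.update U e g) M 1).det = 0} with hm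
  have hmfin : m ≠ ⊤ := measure_ne_top _ _
  have hsub : ∀ ε : ℝ, 0 < ε →
      {g : SU3 | (wilsonDirac (fundamentalRep (Fin 3)) (Function.update U e g) M 1).det = 0} ⊆
        {g | φ g ≤ ε * F₀} := by
    intro ε hε g hg
    simp only [Set.mem_setOf_eq] at hg ⊢
    simp only [hφ, hg, norm_zero]
    positivity
  have hmle : ∀ ε : ℝ, 0 < ε → m.toReal ≤ C * ε ^ c := fun ε hε =>
    (ENNReal.toReal_mono (measure_ne_top _ _) (measure_mono (hsub ε hε))).trans (hsb ε hε)
  by_contra hne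
  have hmpos : 0 < m.toReal := ENNReal.toReal_pos hne hmfin
  -- choose ε with C ε^c = m.toReal / 2
  set ε : ℝ := (m.toReal / (2 * C)) ^ c⁻¹ with hεdef
  have hεpos : 0 < ε := Real.rpow_pos_of_pos (by positivity) _
  have hεc : C * ε ^ c = m.toReal / 2 := by
    rw [hεdef, Real.rpow_inv_rpow (by positivity) hc.ne']
    field_simp
  have := hmle ε hεpos
  rw [hεc] at this
  linarith

include hA in
omit [NeZero L] in
/-- **(3) Single-link domination in `ℝ≥0∞`**: with `f(U) = (ofReal ‖det D_W(U;M)‖)^{-s}` (`= ⊤` on the singular set),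
`∫⁻ f(U[e↦g]) dHaar(g) ≤ (ofReal K) · f(U)` for EVERY `U` and `e`. -/
theorem lintegral_update_negPow_det_le_of :
    ∃ c : ℝ, 0 < c ∧ ∀ s : ℝ, 0 < s → s < c → ∃ K : ℝ, 0 < K ∧ ∀ (L : ℕ) [NeZero L], 4 ≤ L →
      ∀ (M : ℝ) (U : GaugeConfig 4 L SU3) (e : Edge 4 L),
        ∫⁻ g, (ENNReal.ofReal ‖(wilsonDirac (fundamentalRep (Fin 3)) (Function.update U e g) M 1).det‖) ^ (-s)
            ∂(haarProbability SU3) ≤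
          ENNReal.ofReal K * (ENNReal.ofReal ‖(wilsonDirac (fundamentalRep (Fin 3)) U M 1).det‖) ^ (-s) := by
  obtain ⟨c, hc, h⟩ := exists_singleLink_negMoment_of hA
  refine ⟨c, hc, fun s hs hsc => ?_⟩
  obtain ⟨K, hK, hK'⟩ := h s hs hsc
  refine ⟨K, hK, ?_⟩
  intro L _ hL M U e
  have hns : -s < 0 := by linarith
  by_cases hdet : (wilsonDirac (fundamentalRep (Fin 3)) U M 1).det = 0
  · rw [hdet, norm_zero, ENNReal.ofReal_zero, ENNReal.zero_rpow_of_neg hns,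
      ENNReal.mul_top (ENNReal.ofReal_pos.2 hK).ne']
    exact le_top
  · obtain ⟨hint, hle, hnull⟩ := hK' L hL M U e hdet
    have hae : ∀ᵐ g ∂(haarProbability SU3),
        (ENNReal.ofReal ‖(wilsonDirac (fundamentalRep (Fin 3)) (Function.update U e g) M 1).det‖) ^ (-s) =
          ENNReal.ofReal (‖(wilsonDirac (fundamentalRep (Fin 3)) (Function.update U e g) M 1).det‖ ^ (-s)) := by
      have : ∀ᵐ g ∂(haarProbability SU3),
          (wilsonDirac (fundamentalRep (Fin 3)) (Function.update U e g) M 1).det ≠ 0 := by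
        rw [ae_iff]
        simpa only [not_not] using hnull
      filter_upwards [this] with g hg
      exact ENNReal.ofReal_rpow_of_pos (norm_pos_iff.2 hg)
    rw [lintegral_congr_ae hae, ← ofReal_integral_eq_lintegral_ofReal hint
      (Eventually.of_forall fun g => Real.rpow_nonneg (norm_nonneg _) _)]
    calc ENNReal.ofReal (∫ g, ‖(wilsonDirac (fundamentalRep (Fin 3)) (Function.update U e g) M 1).det‖ ^ (-s)
          ∂(haarProbability SU3))
        ≤ ENNReal.ofReal (K * ‖(wilsonDirac (fundamentalRep (Fin 3)) U M 1).det‖ ^ (-s)) :=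
          ENNReal.ofReal_le_ofReal hle
      _ = ENNReal.ofReal K * (ENNReal.ofReal ‖(wilsonDirac (fundamentalRep (Fin 3)) U M 1).det‖) ^ (-s) := by
          rw [ENNReal.ofReal_mul hK.le, ENNReal.ofReal_rpow_of_pos (norm_pos_iff.2 hdet)]

include hA hB in
omit [NeZero L] in
/-- **(3') Induction over the links**: `∫⁻ (ofReal ‖det D_W(U;M)‖)^{-s} dHaar^{⊗E}(U) ≤ (ofReal K)^{#E} (ofReal ‖det D_W(U₀;M)‖)^{-s}`
for every reference field `U₀`. -/
theorem lintegral_pi_negPow_det_le_of :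
    ∃ c : ℝ, 0 < c ∧ ∀ s : ℝ, 0 < s → s < c → ∃ K : ℝ, 0 < K ∧ ∀ (L : ℕ) [NeZero L], 4 ≤ L →
      ∀ (M : ℝ) (U₀ : GaugeConfig 4 L SU3),
        ∫⁻ U, (ENNReal.ofReal ‖(wilsonDirac (fundamentalRep (Fin 3)) U M 1).det‖) ^ (-s)
            ∂(Measure.pi fun _ : Edge 4 L => haarProbability SU3) ≤
          ENNReal.ofReal K ^ Fintype.card (Edge 4 L) *
            (ENNReal.ofReal ‖(wilsonDirac (fundamentalRep (Fin 3)) U₀ M 1).det‖) ^ (-s) := by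
  obtain ⟨c, hc, h⟩ := lintegral_update_negPow_det_le_of hA
  refine ⟨c, hc, fun s hs hsc => ?_⟩
  obtain ⟨K, hK, hK'⟩ := h s hs hsc
  refine ⟨K, hK, ?_⟩
  intro L _ hL M U₀
  have hmeas : Measurable fun U : GaugeConfig 4 L SU3 =>
      (ENNReal.ofReal ‖(wilsonDirac (fundamentalRep (Fin 3)) U M 1).det‖) ^ (-s) :=
    (continuous_norm_det_wilsonDirac M).measurable.ennreal_ofReal.pow_const _
  exact hB (Edge 4 L) SU3 (haarProbability SU3)
    (fun U => (ENNReal.ofReal ‖(wilsonDirac (fundamentalRep (Fin 3)) U M 1).det‖) ^ (-s)) hmeas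
    (ENNReal.ofReal K) (fun e U => hK' L hL M U e) U₀

include hA hB in
omit [NeZero L] in
/-- **Integrability under product Haar**: `‖det D_W(·;M)‖^{-s}` is `Haar^{⊗E}`-integrable for `0 < s < c`. -/
theorem integrable_negPow_det_pi_of :
    ∃ c : ℝ, 0 < c ∧ ∀ s : ℝ, 0 < s → s < c → ∀ (L : ℕ) [NeZero L], 4 ≤ L → ∀ (M : ℝ),
      Integrable (fun U : GaugeConfig 4 L SU3 => ‖(wilsonDirac (fundamentalRep (Fin 3)) U M 1).det‖ ^ (-s))
        (Measure.pi fun _ : Edge 4 L => haarProbability SU3) := by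
  obtain ⟨c, hc, h⟩ := lintegral_pi_negPow_det_le_of hA hB
  refine ⟨c, hc, fun s hs hsc L _ hL M => ?_⟩
  obtain ⟨K, hK, hK'⟩ := h s hs hsc
  have hsm : AEStronglyMeasurable
      (fun U : GaugeConfig 4 L SU3 => ‖(wilsonDirac (fundamentalRep (Fin 3)) U M 1).det‖ ^ (-s))
      (Measure.pi fun _ : Edge 4 L => haarProbability SU3) :=
    ((continuous_norm_det_wilsonDirac M).measurable.pow_const _).aestronglyMeasurable
  by_cases hex : ∃ U₀ : GaugeConfig 4 L SU3, (wilsonDirac (fundamentalRep (Fin 3)) U₀ M 1).det ≠ 0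
  · obtain ⟨U₀, hU₀⟩ := hex
    refine ⟨hsm, ?_⟩
    have hbound := hK' L hL M U₀
    have hpt : ∀ U : GaugeConfig 4 L SU3,
        ‖‖(wilsonDirac (fundamentalRep (Fin 3)) U M 1).det‖ ^ (-s)‖ₑ ≤
          (ENNReal.ofReal ‖(wilsonDirac (fundamentalRep (Fin 3)) U M 1).det‖) ^ (-s) := by
      intro U
      rw [Real.enorm_eq_ofReal (Real.rpow_nonneg (norm_nonneg _) _)]
      by_cases hU : (wilsonDirac (fundamentalRep (Fin 3)) U M 1).det = 0
      · rw [hU, norm_zero, Real.zero_rpow (by linarith), ENNReal.ofReal_zero]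
        exact bot_le
      · rw [ENNReal.ofReal_rpow_of_pos (norm_pos_iff.2 hU)]
    have hfin : ENNReal.ofReal K ^ Fintype.card (Edge 4 L) *
        (ENNReal.ofReal ‖(wilsonDirac (fundamentalRep (Fin 3)) U₀ M 1).det‖) ^ (-s) < ⊤ := by
      refine ENNReal.mul_lt_top (ENNReal.pow_lt_top ENNReal.ofReal_lt_top) ?_
      rw [ENNReal.ofReal_rpow_of_pos (norm_pos_iff.2 hU₀)]
      exact ENNReal.ofReal_lt_top
    exact ((lintegral_mono hpt).trans hbound).trans_lt hfin
  · push Not at hex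
    have : (fun U : GaugeConfig 4 L SU3 => ‖(wilsonDirac (fundamentalRep (Fin 3)) U M 1).det‖ ^ (-s)) =
        fun _ => 0 := by
      funext U
      rw [hex U, norm_zero, Real.zero_rpow (by linarith)]
    rw [this]
    exact integrable_const 0

omit [NeZero L] in
/-- **The Wilson measure is dominated by product Haar**: `μ_W ≤ (Z⁻¹ · e^{R}) · Haar^{⊗E}` with `R` a bound of
`-β S_W` on the compact configuration space. -/
theorem wilsonMeasure_le_smul_pi (L : ℕ) [NeZero L] (β : ℝ) :
    ∃ C : ℝ≥0∞, C ≠ ⊤ ∧ wilsonMeasure (d := 4) (L := L) (fundamentalRep (Fin 3)) β ≤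
      C • (Measure.pi fun _ : Edge 4 L => haarProbability SU3) := by
  obtain ⟨hZ0, -⟩ := partitionFunction_fundamental_ne_zero_and_ne_top (S := L) β
  have hSc : Continuous fun U : GaugeConfig 4 L SU3 => -β * wilsonAction (fundamentalRep (Fin 3)) U :=
    continuous_const.mul (continuous_wilsonAction (fundamentalRep (Fin 3)) (continuous_fundamentalRep (Fin 3)))
  obtain ⟨U₁, -, hU₁⟩ := (isCompact_univ (X := GaugeConfig 4 L SU3)).exists_isMaxOn Set.univ_nonempty
    hSc.continuousOn
  set R : ℝ := -β * wilsonAction (fundamentalRep (Fin 3)) U₁ with hR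
  have hdens : (fun U : GaugeConfig 4 L SU3 => ENNReal.ofReal (Real.exp (-β * wilsonAction (fundamentalRep (Fin 3)) U)))
      ≤ᵐ[Measure.pi fun _ : Edge 4 L => haarProbability SU3] fun _ => ENNReal.ofReal (Real.exp R) :=
    Eventually.of_forall fun U => ENNReal.ofReal_le_ofReal (Real.exp_le_exp.2 (hU₁ (Set.mem_univ U)))
  refine ⟨(partitionFunction (d := 4) (L := L) (fundamentalRep (Fin 3)) β)⁻¹ * ENNReal.ofReal (Real.exp R),
    ENNReal.mul_ne_top (ENNReal.inv_ne_top.2 hZ0) ENNReal.ofReal_ne_top, ?_⟩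
  have hW : wilsonWeight (d := 4) (L := L) (fundamentalRep (Fin 3)) β ≤
      ENNReal.ofReal (Real.exp R) • (Measure.pi fun _ : Edge 4 L => haarProbability SU3) := by
    rw [wilsonWeight, ← withDensity_const]
    exact withDensity_mono hdens
  rw [wilsonMeasure, Measure.le_iff']
  intro t
  have ht : wilsonWeight (d := 4) (L := L) (fundamentalRep (Fin 3)) β t ≤
      ENNReal.ofReal (Real.exp R) * (Measure.pi fun _ : Edge 4 L => haarProbability SU3) t := by
    simpa only [Measure.smul_apply, smul_eq_mul] using Measure.le_iff'.1 hW t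
  simp only [Measure.smul_apply, smul_eq_mul, mul_assoc]
  gcongr

include hA hB in
omit [NeZero L] in
/-- **Negative moments under the Wilson measure** (abstract inputs as hypotheses). -/
theorem wilsonDetNegMoment_of :
    ∃ s₀ : ℝ, 0 < s₀ ∧ ∀ s : ℝ, 0 < s → s < s₀ → ∀ (L : ℕ) [NeZero L], 4 ≤ L → ∀ (β M : ℝ),
      Integrable (fun U : GaugeConfig 4 L SU3 => ‖(wilsonDirac (fundamentalRep (Fin 3)) U M 1).det‖ ^ (-s))
        (wilsonMeasure (fundamentalRep (Fin 3)) β) := by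
  obtain ⟨c, hc, h⟩ := integrable_negPow_det_pi_of hA hB
  refine ⟨c, hc, fun s hs hsc L _ hL β M => ?_⟩
  obtain ⟨C, hC, hle⟩ := wilsonMeasure_le_smul_pi L β
  exact (h s hs hsc L hL M).of_measure_le_smul hC hle

end Inputs

/-- **stub `stub_wilsonDetNegMomentOf` (registered additive stub of crux stmt-QuantumFields-9151)** — the
negative-moment theorem with its two abstract inputs (layer cake, product induction; both landed as stubs of the same
crux) as explicit hypotheses: for `0 < s < s₀`, `L ≥ 4`, every `β` and `M`, `‖det D_W(·;M)‖^{-s}` is integrable under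
the Wilson measure. -/
theorem stub_wilsonDetNegMomentOf :
    (∀ (C c s : ℝ), 0 ≤ C → 0 < s → s < c → ∃ K : ℝ, 0 < K ∧
      ∀ (Ω : Type) [MeasurableSpace Ω] (μ : MeasureTheory.Measure Ω) [MeasureTheory.IsProbabilityMeasure μ]
        (F : Ω → ℝ) (F₀ : ℝ), Measurable F → (∀ ω, 0 ≤ F ω) → 0 < F₀ →
        (∀ ε : ℝ, 0 < ε → (μ {ω | F ω ≤ ε * F₀}).toReal ≤ C * ε ^ c) →
          MeasureTheory.Integrable (fun ω => F ω ^ (-s)) μ ∧ ∫ ω, F ω ^ (-s) ∂μ ≤ K * F₀ ^ (-s)) →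
    (∀ (E X : Type) [Fintype E] [DecidableEq E] [MeasurableSpace X] (μ : MeasureTheory.Measure X)
      [MeasureTheory.IsProbabilityMeasure μ] (f : (E → X) → ENNReal), Measurable f → ∀ C : ENNReal,
      (∀ (e : E) (x : E → X), ∫⁻ g, f (Function.update x e g) ∂μ ≤ C * f x) →
        ∀ x₀ : E → X, ∫⁻ x, f x ∂(MeasureTheory.Measure.pi fun _ : E => μ) ≤ C ^ Fintype.card E * f x₀) →
    ∃ s₀ : ℝ, 0 < s₀ ∧ ∀ s : ℝ, 0 < s → s < s₀ → ∀ (L : ℕ) [NeZero L], 4 ≤ L → ∀ (β M : ℝ),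
      MeasureTheory.Integrable
        (fun U : GaugeConfig 4 L SU3 => ‖(wilsonDirac (fundamentalRep (Fin 3)) U M 1).det‖ ^ (-s))
        (wilsonMeasure (fundamentalRep (Fin 3)) β) :=
  fun hA hB => wilsonDetNegMoment_of hA hB

end Summit.QuantumFields.QCD.Cruxes.PhaseQuenchedFlavourDecay.CrossingSplitIntegrability

end
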